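import Mathlib
import Summits.NavierStokesRegularity.NavierStokesRegularity.Theorems.FilamentSkeletonRssStadiumCornerQuantFoot
import Summits.NavierStokesRegularity.NavierStokesRegularity.Theorems.FilamentSkeletonRssStadiumCornerConj
import Summits.NavierStokesRegularity.NavierStokesRegularity.Theorems.FilamentSkeletonRssStadiumCornerTransport
import Summits.NavierStokesRegularity.NavierStokesRegularity.Theorems.FilamentSkeletonRssStadiumFarPieceHolomorphic
import Summits.NavierStokesRegularity.NavierStokesRegularity.Theorems.FilamentSkeletonRssStadiumFarMajorant
import Summits.NavierStokesRegularity.NavierStokesRegularity.Theorems.FilamentSkeletonRssStadiumSegmentPiece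
import Summits.NavierStokesRegularity.NavierStokesRegularity.Theorems.FilamentSkeletonRssStadiumChordPerturb
import Summits.NavierStokesRegularity.NavierStokesRegularity.Theorems.FilamentSkeletonRssStadiumTangentModulus
import Summits.NavierStokesRegularity.NavierStokesRegularity.Theorems.FilamentSkeletonRssStadiumDeviationPackage

/-!
# Route `FilamentSkeletonRss` · cruxes `SkeletonJ1L` (stmt-NavierStokesRegularity-23296, registered stub `stub_tangentSkeletonL` ≡
# `TangentSkeletonNearStraightL`, stmt-23320) · line `child_tangent_analytic_strip_L` (b0b56c52900dd90a), stub `stub_stripPropagation` —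
# brick for `rcore`: THE LEFT FOOT TAIL OF THE QUARTER-WIDTH TENT (mirror of `Theorems.StadiumQuarterFootTail`; self-contained imports)

Real sources to the LEFT of the target (`Re z − σ ≥ hs/2`) for every target of the quarter stadium: the margin `(Re z − σ)²/4 ≤ Re Σᵢ (Fᵢ z − Xᵢ σ)²`
(`quarter_foot_re_ge_left`) is the right-foot margin of the POINT-REFLECTED data `F ∘ (−·)`, `X ∘ (−·)` (`Theorems.StadiumCornerTransport.reflect_package`
with `x = 0`: stadium centre `−cc`, target `−z`, source `−σ`), which satisfy the same stadium hypotheses; then, exactly as on the right,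
`quarter_foot_kernel_le_left` (`(x₀ − σ)²/16` margin, Lorentzian majorant `1280·((σ − x₀)² + hs²)⁻¹` for `σ ≤ x₀ − hs`, `|Re z − x₀| < hs/2`) and
`quarter_foot_tail_left` (the tail `∫_{σ ≤ x₀ − hs}` is holomorphic on the anchor's target box and `≤ 1280·π/hs`).  With `Theorems.StadiumFrozenRealPiece`
(compact parts) these are the `hfeet` inputs of `Theorems.StadiumTentFreezeNhds.tent_eq_frozen_nhds_sharp` for both feet.
HONEST FRAMING: a brick for the bookkeeping of a HYPOTHETICAL filament skeleton on the NEGATIVE side of a MODEL route; the stub `stub_stripPropagation`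
is NOT closed by this file, `TangentSkeletonNearStraightL` / `SkeletonJ1L` stay OPEN; nothing here bears on Navier–Stokes regularity or blow-up.
`--supports stmt-NavierStokesRegularity-23320` (≡ stub `stub_tangentSkeletonL` of 23296).
-/

set_option linter.dupNamespace false

noncomputable section

namespace Summit.NavierStokesRegularity.NavierStokesRegularity.Theorems.StadiumQuarterFootTailLeft

open Set Filter Topology Complex MeasureTheory Metric
open scoped InnerProductSpace Matrix ComplexConjugate
open Summit.NavierStokesRegularity.NavierStokesRegularity.Theorems.StadiumCornerQuantFoot
open Summit.NavierStokesRegularity.NavierStokesRegularity.Theorems.StadiumCornerConj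
open Summit.NavierStokesRegularity.NavierStokesRegularity.Theorems.StadiumCornerTransport
open Summit.NavierStokesRegularity.NavierStokesRegularity.Theorems.StadiumFarPieceHolomorphic
open Summit.NavierStokesRegularity.NavierStokesRegularity.Theorems.StadiumFarMajorant
open Summit.NavierStokesRegularity.NavierStokesRegularity.Theorems.StadiumSegmentPiece
open Summit.NavierStokesRegularity.NavierStokesRegularity.Theorems.StadiumChordPerturb
open Summit.NavierStokesRegularity.NavierStokesRegularity.Theorems.StadiumTangentModulus
open Summit.NavierStokesRegularity.NavierStokesRegularity.Theorems.StadiumDeviationPackage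
open Summit.NavierStokesRegularity.NavierStokesRegularity.Theorems.StadiumPartnerPiece

/-- (private copy of `Theorems.StadiumQuarterFootTail.re_chord_sq_real_conj`, whose module had no farm olean at landing time) **Conjugate targets see real sources alike.**  `F` holomorphic on the stadium with a real trace; for `z ∈ S` and a real vector `r`:
`Re Σᵢ (Fᵢ z̄ − rᵢ)² = Re Σᵢ (Fᵢ z − rᵢ)²` (`Theorems.StadiumCornerConj.stadium_conj_symm`). [folklore] -/
private theorem re_chord_sq_real_conj_aux {hs L cc : ℝ} {F : ℂ → (Fin 3 → ℂ)}
    (hF : DifferentiableOn ℂ F {z : ℂ | |z.im| < hs ∧ |z.re - cc| < L + hs})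
    {X : ℝ → EuclideanSpace ℝ (Fin 3)}
    (hFX : ∀ r : ℝ, (r : ℂ) ∈ {z : ℂ | |z.im| < hs ∧ |z.re - cc| < L + hs} →
      F r = fun i => ((⟪X r, EuclideanSpace.single i (1:ℝ)⟫_ℝ : ℝ) : ℂ))
    (hhs : 0 < hs) (hLs : 0 < L + hs) {z : ℂ} (hz : z ∈ {z : ℂ | |z.im| < hs ∧ |z.re - cc| < L + hs}) (r : Fin 3 → ℝ) :
    (∑ i, (F (conj z) i - ((r i : ℝ) : ℂ)) ^ 2).re = (∑ i, (F z i - ((r i : ℝ) : ℂ)) ^ 2).re := by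
  have hsymm : ∀ i, F (conj z) i = conj (F z i) := fun i => stadium_conj_symm hF hFX hhs hLs hz i
  have h : (∑ i, (F (conj z) i - ((r i : ℝ) : ℂ)) ^ 2) = conj (∑ i, (F z i - ((r i : ℝ) : ℂ)) ^ 2) := by
    rw [map_sum]
    refine Finset.sum_congr rfl fun i _ => ?_
    rw [hsymm i, map_pow, map_sub, Complex.conj_ofReal]
  rw [h, Complex.conj_re]

/-- (private copy of `Theorems.StadiumQuarterFootTail.quarter_foot_re_ge`) **The right foot of every target of the quarter stadium is on the principal branch, quantitatively.**  Stadium data as in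
`Theorems.StadiumCornerQuantFoot`; target `z` with `|Im z| < hs/4`, `|Re z − cc| < L + hs/4`; real source `σ` with `hs/2 ≤ σ − Re z`.  Then
`(σ − Re z)²/4 ≤ Re Σᵢ (Fᵢ z − Xᵢ σ)²`. [folklore] -/
private theorem quarter_foot_re_ge_aux {hs L cc : ℝ} {F : ℂ → (Fin 3 → ℂ)}
    (hF : DifferentiableOn ℂ F {z : ℂ | |z.im| < hs ∧ |z.re - cc| < L + hs})
    (hM : ∀ z ∈ {z : ℂ | |z.im| < hs ∧ |z.re - cc| < L + hs}, ‖deriv F z‖ ≤ 2)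
    (hunit : ∀ w ∈ {z : ℂ | |z.im| < hs ∧ |z.re - cc| < L + hs}, ∑ i, (deriv F w i) ^ 2 = 1)
    {X : ℝ → EuclideanSpace ℝ (Fin 3)} (hX : ContDiff ℝ 1 X) (hXu : ∀ τ, ‖deriv X τ‖ = 1)
    {Rb : ℝ} (hRb0 : 0 ≤ Rb) (hRb : Rb ≤ 1 / 2) (hosc : ∀ τ σ, ‖deriv X τ - deriv X σ‖ ≤ Rb)
    (hFX : ∀ r : ℝ, (r : ℂ) ∈ {z : ℂ | |z.im| < hs ∧ |z.re - cc| < L + hs} →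
      F r = fun i => ((⟪X r, EuclideanSpace.single i (1:ℝ)⟫_ℝ : ℝ) : ℂ))
    (hhs : 0 < hs) {z : ℂ} (hzim : |z.im| < hs / 4) (hzre : |z.re - cc| < L + hs / 4) {σ : ℝ} (hσ : hs / 2 ≤ σ - z.re) :
    (σ - z.re) ^ 2 / 4 ≤ (∑ i, (F z i - ((X σ i : ℝ) : ℂ)) ^ 2).re := by
  -- re-centre the stadium at the target abscissa
  obtain ⟨hlo, hhi, hcc, hlt⟩ := centre_at_target (hs := hs) (L := L) (cc := cc) hzre
  obtain ⟨hF', hM', hunit', hFX'⟩ := restrict_package hF hM hunit hFX hlo hhi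
  set x : ℝ := z.re with hx
  set D : ℝ := σ - x with hD
  have hDhs : hs / 2 ≤ D := hσ
  have hDpos : 0 < D := by linarith
  -- the certificate at height `|Im z|`, transported to `z` (conjugation if `Im z < 0`)
  have key : (7 / 8 * D - 0.0398 * hs) ^ 2 - (hs / 4 + 0.0389 * hs) ^ 2 ≤ (∑ i, (F z i - ((X σ i : ℝ) : ℂ)) ^ 2).re := by
    have hY0 : 0 ≤ |z.im| := abs_nonneg _
    have h := corner_right_foot_re_ge hF' hM' hunit' hX hXu hRb0 hRb hosc hFX' hhs (x₀ := x) (Y := |z.im|) (D := D)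
      hY0 hzim hlt hcc hDhs
    have hσ' : x + D = σ := by simp [hD]
    rw [hσ'] at h
    simp_rw [inner_single_eq] at h
    by_cases hy : 0 ≤ z.im
    · have hz' : ((x : ℂ) + ((|z.im| : ℝ) : ℂ) * Complex.I) = z := by
        rw [abs_of_nonneg hy]; exact Complex.ext (by simp [hx]) (by simp [hx])
      rwa [hz'] at h
    · rw [not_le] at hy
      have hz' : ((x : ℂ) + ((|z.im| : ℝ) : ℂ) * Complex.I) = conj z := by
        rw [abs_of_neg hy]; exact Complex.ext (by simp [hx]) (by simp [hx])
      rw [hz'] at h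
      have hLs : 0 < L + hs := by
        have : 0 ≤ |z.re - cc| := abs_nonneg _
        linarith
      have hzS : z ∈ {z : ℂ | |z.im| < hs ∧ |z.re - cc| < L + hs} := ⟨by linarith, by linarith⟩
      rwa [re_chord_sq_real_conj_aux hF hFX hhs hLs hzS (fun i => X σ i)] at h
  -- numerics: `((7/8)D − 0.0398hs)² − (0.2889hs)² ≥ D²/4` for `hs ≤ 2D`
  have h2D : hs ≤ 2 * D := by linarith
  have h1 : 0.7954 * D ≤ 7 / 8 * D - 0.0398 * hs := by nlinarith
  have h1' : (0.7954 * D) ^ 2 ≤ (7 / 8 * D - 0.0398 * hs) ^ 2 :=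
    pow_le_pow_left₀ (by positivity) h1 2
  have h3 : hs / 4 + 0.0389 * hs ≤ 0.5778 * D := by nlinarith
  have h3' : (hs / 4 + 0.0389 * hs) ^ 2 ≤ (0.5778 * D) ^ 2 :=
    pow_le_pow_left₀ (by positivity) h3 2
  nlinarith [h1', h3', key, sq_nonneg D]


/-- **The left foot of every target of the quarter stadium, quantitatively** (point reflection of `quarter_foot_re_ge`): for `|Im z| < hs/4`,
`|Re z − cc| < L + hs/4` and a real source with `hs/2 ≤ Re z − σ`: `(Re z − σ)²/4 ≤ Re Σᵢ (Fᵢ z − Xᵢ σ)²`. [folklore] -/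
theorem quarter_foot_re_ge_left {hs L cc : ℝ} {F : ℂ → (Fin 3 → ℂ)}
    (hF : DifferentiableOn ℂ F {z : ℂ | |z.im| < hs ∧ |z.re - cc| < L + hs})
    (hM : ∀ z ∈ {z : ℂ | |z.im| < hs ∧ |z.re - cc| < L + hs}, ‖deriv F z‖ ≤ 2)
    (hunit : ∀ w ∈ {z : ℂ | |z.im| < hs ∧ |z.re - cc| < L + hs}, ∑ i, (deriv F w i) ^ 2 = 1)
    {X : ℝ → EuclideanSpace ℝ (Fin 3)} (hX : ContDiff ℝ 1 X) (hXu : ∀ τ, ‖deriv X τ‖ = 1)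
    {Rb : ℝ} (hRb0 : 0 ≤ Rb) (hRb : Rb ≤ 1 / 2) (hosc : ∀ τ σ, ‖deriv X τ - deriv X σ‖ ≤ Rb)
    (hFX : ∀ r : ℝ, (r : ℂ) ∈ {z : ℂ | |z.im| < hs ∧ |z.re - cc| < L + hs} →
      F r = fun i => ((⟪X r, EuclideanSpace.single i (1:ℝ)⟫_ℝ : ℝ) : ℂ))
    (hhs : 0 < hs) {z : ℂ} (hzim : |z.im| < hs / 4) (hzre : |z.re - cc| < L + hs / 4) {σ : ℝ} (hσ : hs / 2 ≤ z.re - σ) :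
    (z.re - σ) ^ 2 / 4 ≤ (∑ i, (F z i - ((X σ i : ℝ) : ℂ)) ^ 2).re := by
  obtain ⟨hF', hM', hunit', hX', hXu', hosc', hFX'⟩ := reflect_package (x := (0:ℝ)) hF hM hunit hX hXu hosc hFX
  have hzim' : |(2 * ((0:ℝ) : ℂ) - z).im| < hs / 4 := by simpa using hzim
  have hzre' : |(2 * ((0:ℝ) : ℂ) - z).re - (2 * 0 - cc)| < L + hs / 4 := by
    have : (2 * ((0:ℝ) : ℂ) - z).re - (2 * 0 - cc) = -(z.re - cc) := by simp; ring
    rw [this, abs_neg]; exact hzre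
  have hσ' : hs / 2 ≤ (-σ) - (2 * ((0:ℝ) : ℂ) - z).re := by
    have e : (2 * ((0:ℝ) : ℂ) - z).re = -z.re := by simp
    rw [e]; linarith
  have h := quarter_foot_re_ge_aux hF' hM' hunit' hX' hXu' hRb0 hRb hosc' hFX' hhs hzim' hzre' hσ'
  have e1 : (2 * ((0:ℝ) : ℂ) - (2 * ((0:ℝ) : ℂ) - z)) = z := by ring
  have e2 : (2 * (0:ℝ) - -σ) = σ := by ring
  simp only [e1, e2] at h
  have e3 : (-σ - (2 * ((0:ℝ) : ℂ) - z).re) ^ 2 = (z.re - σ) ^ 2 := by simp; ring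
  rw [e3] at h
  exact h

/-- **Pointwise kernel bound on the left foot tail** (mirror of `quarter_foot_kernel_le`): targets with `|Im z| < hs/4`, `|Re z − cc| < L + hs/4`,
`|Re z − x₀| < hs/2`; sources `σ ≤ x₀ − hs`; core `κ·A σ ≥ 0`.  Then `(x₀ − σ)²/16 ≤ Re(base)` and `‖kernel‖ ≤ 1280·((σ − x₀)² + hs²)⁻¹`. [folklore] -/
theorem quarter_foot_kernel_le_left {hs L cc κ : ℝ} {F : ℂ → (Fin 3 → ℂ)}
    (hF : DifferentiableOn ℂ F {z : ℂ | |z.im| < hs ∧ |z.re - cc| < L + hs})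
    (hM : ∀ z ∈ {z : ℂ | |z.im| < hs ∧ |z.re - cc| < L + hs}, ‖deriv F z‖ ≤ 2)
    (hunit : ∀ w ∈ {z : ℂ | |z.im| < hs ∧ |z.re - cc| < L + hs}, ∑ i, (deriv F w i) ^ 2 = 1)
    {X : ℝ → EuclideanSpace ℝ (Fin 3)} (hX : ContDiff ℝ 1 X) (hXu : ∀ τ, ‖deriv X τ‖ = 1)
    {Rb : ℝ} (hRb0 : 0 ≤ Rb) (hRb : Rb ≤ 1 / 2) (hosc : ∀ τ σ, ‖deriv X τ - deriv X σ‖ ≤ Rb)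
    (hFX : ∀ r : ℝ, (r : ℂ) ∈ {z : ℂ | |z.im| < hs ∧ |z.re - cc| < L + hs} →
      F r = fun i => ((⟪X r, EuclideanSpace.single i (1:ℝ)⟫_ℝ : ℝ) : ℂ))
    {A : ℝ → ℝ} (hA : ∀ σ, 0 ≤ A σ) (hκ : 0 ≤ κ)
    (hhs : 0 < hs) {x₀ : ℝ} {z : ℂ} (hzim : |z.im| < hs / 4) (hzre : |z.re - cc| < L + hs / 4) (hzx : |z.re - x₀| < hs / 2)
    {σ : ℝ} (hσ : σ ≤ x₀ - hs) :
    (x₀ - σ) ^ 2 / 16 ≤ ((∑ i, (F z i - ((X σ i : ℝ) : ℂ)) ^ 2) + ((κ * A σ : ℝ) : ℂ)).re ∧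
    ‖(((∑ i, (F z i - ((X σ i : ℝ) : ℂ)) ^ 2) + ((κ * A σ : ℝ) : ℂ)) ^ ((3:ℂ) / 2))⁻¹ •
        ((fun i => ((deriv X σ i : ℝ) : ℂ)) ⨯₃ (fun i => F z i - ((X σ i : ℝ) : ℂ)))‖ ≤
      1280 * ((1:ℝ) ^ 2 * (σ - x₀) ^ 2 + hs ^ 2)⁻¹ := by
  set S : Set ℂ := {z : ℂ | |z.im| < hs ∧ |z.re - cc| < L + hs} with hS
  have hzx' := abs_lt.mp hzx
  have hDx : hs ≤ x₀ - σ := by linarith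
  have hD0 : 0 < x₀ - σ := by linarith
  have hσz : hs / 2 ≤ z.re - σ := by linarith
  -- margin
  have hre := quarter_foot_re_ge_left hF hM hunit hX hXu hRb0 hRb hosc hFX hhs hzim hzre hσz
  have hκA : 0 ≤ κ * A σ := mul_nonneg hκ (hA σ)
  have hmargin : (x₀ - σ) ^ 2 / 16 ≤ ((∑ i, (F z i - ((X σ i : ℝ) : ℂ)) ^ 2) + ((κ * A σ : ℝ) : ℂ)).re := by
    rw [Complex.add_re, Complex.ofReal_re]
    have : (x₀ - σ) ^ 2 / 16 ≤ (z.re - σ) ^ 2 / 4 := by nlinarith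
    linarith
  refine ⟨hmargin, ?_⟩
  have hLs : 0 < L + hs := by have : 0 ≤ |z.re - cc| := abs_nonneg _; linarith
  have hzS : z ∈ S := ⟨by linarith, by linarith⟩
  have hxS : ((z.re : ℝ) : ℂ) ∈ S := ⟨by simpa using hhs, by simpa using (by linarith : |z.re - cc| < L + hs)⟩
  have hFx : F (z.re : ℝ) = fun i => ((X z.re i : ℝ) : ℂ) := by
    rw [hFX z.re hxS]; funext i; rw [inner_single_eq]
  have hchord : ‖(fun i => F z i - ((X σ i : ℝ) : ℂ))‖ ≤ 2 * (x₀ - σ) := by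
    have e : (fun i => F z i - ((X σ i : ℝ) : ℂ)) =
        (F z - F (z.re : ℝ)) + (fun i => ((⟪X z.re - X σ, EuclideanSpace.single i (1:ℝ)⟫_ℝ : ℝ) : ℂ)) := by
      funext i
      simp only [Pi.add_apply, Pi.sub_apply, hFx, inner_single_eq, PiLp.sub_apply, Complex.ofReal_sub]
      ring
    rw [e]
    have h1 : ‖F z - F (z.re : ℝ)‖ ≤ 2 * ‖z - (z.re : ℂ)‖ := (component_lipschitz hF hM hzS hxS).1
    have h1' : ‖z - (z.re : ℂ)‖ = |z.im| := by
      have : z - (z.re : ℂ) = (z.im : ℂ) * Complex.I := Complex.ext (by simp) (by simp)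
      rw [this, norm_mul, Complex.norm_real, Complex.norm_I, mul_one, Real.norm_eq_abs]
    have h2 : ‖(fun i => ((⟪X z.re - X σ, EuclideanSpace.single i (1:ℝ)⟫_ℝ : ℝ) : ℂ))‖ ≤ |z.re - σ| :=
      (norm_cplx_le _).trans (norm_sub_le_of_unit_speed hX.differentiable_one hXu _ _)
    have h2' : |z.re - σ| = z.re - σ := abs_of_pos (by linarith)
    calc ‖(F z - F (z.re : ℝ)) + (fun i => ((⟪X z.re - X σ, EuclideanSpace.single i (1:ℝ)⟫_ℝ : ℝ) : ℂ))‖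
        ≤ ‖F z - F (z.re : ℝ)‖ + ‖(fun i => ((⟪X z.re - X σ, EuclideanSpace.single i (1:ℝ)⟫_ℝ : ℝ) : ℂ))‖ := norm_add_le _ _
      _ ≤ 2 * |z.im| + (z.re - σ) := by rw [← h1', ← h2']; exact add_le_add h1 h2
      _ ≤ 2 * (x₀ - σ) := by
          have : |z.im| < hs / 4 := hzim
          linarith
  have hD1 : ‖(fun i => ((deriv X σ i : ℝ) : ℂ))‖ ≤ 1 := by
    refine (pi_norm_le_iff_of_nonneg zero_le_one).2 fun i => ?_
    rw [Complex.norm_real]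
    exact (PiLp.norm_apply_le (deriv X σ) i).trans (hXu σ).le
  have hμ : 0 < (x₀ - σ) ^ 2 / 16 := by positivity
  have hker := segment_kernel_norm_le hμ hmargin hD1 hchord
  refine hker.trans ?_
  have hD4 : 0 < (x₀ - σ) / 4 := by positivity
  have hpow : ((x₀ - σ) ^ 2 / 16) ^ (-(3/2 : ℝ)) = (((x₀ - σ) / 4) ^ 3)⁻¹ := by
    have hb : (x₀ - σ) ^ 2 / 16 = ((x₀ - σ) / 4) ^ (2:ℝ) := by
      rw [Real.rpow_two]; ring
    rw [hb, ← Real.rpow_mul hD4.le, show (2:ℝ) * -(3/2 : ℝ) = -(3:ℝ) by norm_num, Real.rpow_neg hD4.le,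
      show (3:ℝ) = ((3:ℕ) : ℝ) by norm_num, Real.rpow_natCast]
  rw [hpow]
  have e256 : (((x₀ - σ) / 4) ^ 3)⁻¹ * (2 * 1 * (2 * (x₀ - σ))) = 256 / (x₀ - σ) ^ 2 := by
    field_simp
    ring
  rw [e256]
  have hfar := far_majorant_le (a := hs) (k := 1) (C := 256) (σ₀ := x₀) (σ := σ) (d := x₀ - σ) hhs zero_le_one
    (by norm_num) hDx (by rw [abs_of_neg (by linarith : σ - x₀ < 0)]; linarith)
  linarith [hfar]

/-- **The left foot tail of the quarter-width tent is holomorphic and `O(1/hs)` on the anchor's target box** (mirror of `quarter_foot_tail`):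
sources `σ ≤ x₀ − hs`. [folklore] -/
theorem quarter_foot_tail_left {hs L cc κ : ℝ} {F : ℂ → (Fin 3 → ℂ)}
    (hF : DifferentiableOn ℂ F {z : ℂ | |z.im| < hs ∧ |z.re - cc| < L + hs})
    (hM : ∀ z ∈ {z : ℂ | |z.im| < hs ∧ |z.re - cc| < L + hs}, ‖deriv F z‖ ≤ 2)
    (hunit : ∀ w ∈ {z : ℂ | |z.im| < hs ∧ |z.re - cc| < L + hs}, ∑ i, (deriv F w i) ^ 2 = 1)
    {X : ℝ → EuclideanSpace ℝ (Fin 3)} (hX : ContDiff ℝ 1 X) (hXu : ∀ τ, ‖deriv X τ‖ = 1)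
    {Rb : ℝ} (hRb0 : 0 ≤ Rb) (hRb : Rb ≤ 1 / 2) (hosc : ∀ τ σ, ‖deriv X τ - deriv X σ‖ ≤ Rb)
    (hFX : ∀ r : ℝ, (r : ℂ) ∈ {z : ℂ | |z.im| < hs ∧ |z.re - cc| < L + hs} →
      F r = fun i => ((⟪X r, EuclideanSpace.single i (1:ℝ)⟫_ℝ : ℝ) : ℂ))
    {A : ℝ → ℝ} (hAc : Continuous A) (hA : ∀ σ, 0 ≤ A σ) (hκ : 0 ≤ κ) (hhs : 0 < hs) (x₀ : ℝ) :
    DifferentiableOn ℂ (fun z => ∫ σ in Iic (x₀ - hs),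
      (((∑ i, (F z i - ((X σ i : ℝ) : ℂ)) ^ 2) + ((κ * A σ : ℝ) : ℂ)) ^ ((3:ℂ) / 2))⁻¹ •
        ((fun i => ((deriv X σ i : ℝ) : ℂ)) ⨯₃ (fun i => F z i - ((X σ i : ℝ) : ℂ))))
      ({z : ℂ | |z.im| < hs / 4 ∧ |z.re - cc| < L + hs / 4} ∩ {z : ℂ | |z.im| < hs / 4 ∧ |z.re - x₀| < hs / 2}) ∧
    ∀ z ∈ ({z : ℂ | |z.im| < hs / 4 ∧ |z.re - cc| < L + hs / 4} ∩ {z : ℂ | |z.im| < hs / 4 ∧ |z.re - x₀| < hs / 2}),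
      ‖∫ σ in Iic (x₀ - hs),
        (((∑ i, (F z i - ((X σ i : ℝ) : ℂ)) ^ 2) + ((κ * A σ : ℝ) : ℂ)) ^ ((3:ℂ) / 2))⁻¹ •
          ((fun i => ((deriv X σ i : ℝ) : ℂ)) ⨯₃ (fun i => F z i - ((X σ i : ℝ) : ℂ)))‖ ≤ 1280 * (Real.pi / (1 * hs)) := by
  set S : Set ℂ := {z : ℂ | |z.im| < hs ∧ |z.re - cc| < L + hs} with hS
  set B : Set ℂ := {z : ℂ | |z.im| < hs / 4 ∧ |z.re - cc| < L + hs / 4} ∩ {z : ℂ | |z.im| < hs / 4 ∧ |z.re - x₀| < hs / 2}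
    with hB
  have hBo : IsOpen B := (isOpen_stadium (hs / 4) (L + hs / 4) cc).inter (isOpen_stadium (hs / 4) (hs / 2) x₀)
  have hBS : B ⊆ S := fun z hz => ⟨by linarith [hz.1.1], by linarith [hz.1.2]⟩
  have hT : MeasurableSet (Iic (x₀ - hs)) := measurableSet_Iic
  have hpt : ∀ z ∈ B, ∀ σ ∈ Iic (x₀ - hs),
      (x₀ - σ) ^ 2 / 16 ≤ ((∑ i, (F z i - ((X σ i : ℝ) : ℂ)) ^ 2) + ((κ * A σ : ℝ) : ℂ)).re ∧
      ‖(((∑ i, (F z i - ((X σ i : ℝ) : ℂ)) ^ 2) + ((κ * A σ : ℝ) : ℂ)) ^ ((3:ℂ) / 2))⁻¹ •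
          ((fun i => ((deriv X σ i : ℝ) : ℂ)) ⨯₃ (fun i => F z i - ((X σ i : ℝ) : ℂ)))‖ ≤
        1280 * ((1:ℝ) ^ 2 * (σ - x₀) ^ 2 + hs ^ 2)⁻¹ :=
    fun z hz σ hσ => quarter_foot_kernel_le_left hF hM hunit hX hXu hRb0 hRb hosc hFX hA hκ hhs hz.1.1 hz.1.2 hz.2.2 hσ
  have hpos : ∀ z ∈ B, ∀ σ ∈ Iic (x₀ - hs),
      0 < ((∑ i, (F z i - ((X σ i : ℝ) : ℂ)) ^ 2) + ((κ * A σ : ℝ) : ℂ)).re := by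
    intro z hz σ hσ
    have h := (hpt z hz σ hσ).1
    have hσ' : σ ≤ x₀ - hs := hσ
    have : 0 < (x₀ - σ) ^ 2 / 16 := by
      have : 0 < x₀ - σ := by linarith
      positivity
    linarith
  have hint : Integrable (fun σ : ℝ => 1280 * ((1:ℝ) ^ 2 * (σ - x₀) ^ 2 + hs ^ 2)⁻¹) :=
    (integrable_lorentzian hhs one_ne_zero x₀).const_mul _
  refine ⟨differentiableOn_farPiece hBo (hF.mono hBS) hX hAc hT hpos hint.integrableOn
      (fun z hz σ hσ => (hpt z hz σ hσ).2), ?_⟩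
  intro z hz
  have h1 : ‖∫ σ in Iic (x₀ - hs),
      (((∑ i, (F z i - ((X σ i : ℝ) : ℂ)) ^ 2) + ((κ * A σ : ℝ) : ℂ)) ^ ((3:ℂ) / 2))⁻¹ •
        ((fun i => ((deriv X σ i : ℝ) : ℂ)) ⨯₃ (fun i => F z i - ((X σ i : ℝ) : ℂ)))‖ ≤
      ∫ σ in Iic (x₀ - hs), 1280 * ((1:ℝ) ^ 2 * (σ - x₀) ^ 2 + hs ^ 2)⁻¹ := by
    refine norm_integral_le_of_norm_le hint.integrableOn ?_
    filter_upwards [ae_restrict_mem hT] with σ hσ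
    exact (hpt z hz σ hσ).2
  have h2 : ∫ σ in Iic (x₀ - hs), 1280 * ((1:ℝ) ^ 2 * (σ - x₀) ^ 2 + hs ^ 2)⁻¹ ≤
      ∫ σ, 1280 * ((1:ℝ) ^ 2 * (σ - x₀) ^ 2 + hs ^ 2)⁻¹ :=
    setIntegral_le_integral hint (Filter.Eventually.of_forall fun σ => by positivity)
  refine h1.trans (h2.trans ?_)
  rw [integral_const_mul, integral_lorentzian hhs one_ne_zero x₀, abs_one]

end Summit.NavierStokesRegularity.NavierStokesRegularity.Theorems.StadiumQuarterFootTailLeft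

end
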